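import Summits.CriticalPhenomena.PercolationContinuityZ3.Theorems.PercNearOneGluingNoHeavyQuantThreeClusterCutOff
import HarnessLib

/-!
# Structure of the residual `R₀` of the three-cluster product row: two one-sided separators

builds on p205010 (kernel theorem, internal audit signed; external expert review pending)

Support file (`--supports stmt-CriticalPhenomena-4575`), seat `prim-quant-p1` (gen 42); memo
`run/shared/lean/prim/quant/prim-quant-p1-g42/FOR-LEAD-Z32-CUTOFF.md` §2.  No definitions, no named facts, no sorries; standard axioms.

After ✓ p611369 `ThreeClusterSwap.productRow_le_two_add_Pr2W` the product row F1 (hence the three-port case of `Z(3,2)`, ✓ p560550)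
hinges on the residual set `R₀` of pairs `(C₂, C₁)` (`C₂ ∈ a|b|c`, `C₁ ∈ abc`) on which both single seals (p1 g40) and both cut-off
swaps (p1 g42) fail.  This file proves the structural fact behind every further attack recorded in the memo:

* `residual_separator` (arbitrary vertex type, arbitrary edge sets): if `c ∉ S := C_b(C₂)`, the `b`-seal fails (`a` is not
  joined to `c` by `C₁`-edges avoiding `S`) and the cut-off towards `c` fails (`a ↮ b` in `C₁ ∖ E(Q, S)`, `Q` = the `C₁`-cluster of
  `c` avoiding `S`), then ALREADY `S ∖ {b}` separates `a` from `b` AND from `c` in `C₁` (every `C₁`-path from `a` to `b` or `c`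
  uses an edge touching `S ∖ {b}`).  Proof: the `(C₁ ∖ E(Q,S))`-cluster `T` of `a` meets neither `b` nor `Q`, and its only
  `C₁`-open exits are edges of `E(Q, S)` whose `T`-endpoint lies in `S ∖ {b}`.
* `R0_double_separator` (finite edge type, the set `R₀` verbatim as in ✓ p611369): on `R₀` both `C_b(C₂) ∖ {b}` and
  `C_c(C₂) ∖ {c}` separate `a` from `{b, c}` in `C₁`.
So a pair in `R₀` has `a` "behind two collars": `b` (resp. `c`) is joined to the rest of its own `C₂`-cluster only through vertices that
every `C₁`-path from `a` must cross.  (Memo §3–§4: this is what makes the third pair of maps `Ψ_P`, `Ψ_R` of the memo land in the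
target cells, and what the census of `R₀` reflects — empty on ≤ 5 vertices, 8 configuration classes on 6, 1 572 on 7.)
-/

namespace Summit.CriticalPhenomena.PercolationContinuityZ3.Theorems

open Literature.Probability.Percolation Literature.Probability.Percolation.DecisionTree

variable {V : Type*}

namespace ThreeClusterSwap

section Residual

variable (C₁ C₂ : Set (Sym2 V)) (a b c : V) (S Q : Set V) (TS F : Set (Sym2 V))

/-- **The residual has a one-sided separator.**  With `S = C_b(C₂)`, `c ∉ S`, `Q` the `C₁`-cluster of `c` avoiding `S`,
`F = E(Q, S)`: if `a` is not `C₁`-joined to `c` avoiding `S` (the `b`-seal fails) and `a ↮ b` in `C₁ ∖ F` (the cut-off towards `c`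
fails), then `a` is joined neither to `b` nor to `c` by `C₁`-open edges avoiding `S ∖ {b}`. [this work] -/
theorem residual_separator (hS : S = {v | (openGraph C₂).Reachable b v}) (hTS : TS = {e | ∃ v ∈ S, v ∈ e})
    (hQ : Q = {v | (openGraph (C₁ \ TS)).Reachable c v}) (hF : F = {e | ∃ q ∈ Q, ∃ s ∈ S, e = s(q, s)})
    (hc : c ∉ S) (hσ : ¬ (openGraph (C₁ \ TS)).Reachable c a) (hκ : ¬ (openGraph (C₁ \ F)).Reachable a b)
    {t : V} (ht : t = b ∨ t = c) :
    ¬ (openGraph (C₁ \ {e | ∃ v ∈ S, v ≠ b ∧ v ∈ e})).Reachable a t := by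
  intro h
  -- `T` = the `(C₁ ∖ F)`-cluster of `a`; it meets neither `Q` (else `a ∈ Q`) nor `b`
  have hTQ : ∀ u, (openGraph (C₁ \ F)).Reachable a u → u ∉ Q := by
    intro u hu huQ
    have hcu : (openGraph (C₁ \ F)).Reachable c u :=
      (cut_reachable_iff C₁ c S Q TS F hTS hQ hF hc u).2 (by rw [hQ] at huQ; exact huQ)
    exact hσ ((cut_reachable_iff C₁ c S Q TS F hTS hQ hF hc a).1 (hcu.trans hu.symm))
  -- every step of a `C₁`-path avoiding `S ∖ {b}` out of `T` stays in `T`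
  have key := reachable_transfer (G' := openGraph (C₁ \ F)) (P := fun u => (openGraph (C₁ \ F)).Reachable a u) h
    (SimpleGraph.Reachable.refl a) (by
      intro u w hu huw
      rw [openGraph_adj] at huw
      obtain ⟨⟨h1, hnP⟩, hne⟩ := huw
      have hnF : s(u, w) ∉ F := by
        intro hf
        rw [hF] at hf
        obtain ⟨q, hq, s, hs, he⟩ := hf
        -- the edge avoids `S ∖ {b}`, so its `S`-endpoint is `b`
        have hsb : s = b := by
          by_contra hsb
          exact hnP ⟨s, hs, hsb, by rw [he]; exact Sym2.mem_mk_right q s⟩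
        rw [hsb] at he
        -- then `u = q ∈ Q` or `u = b`, both impossible for a vertex of `T`
        have hu' : u = q ∨ u = b := by
          have : u ∈ s(q, b) := by rw [← he]; exact Sym2.mem_mk_left u w
          exact Sym2.mem_iff.1 this
        rcases hu' with rfl | rfl
        · exact hTQ u hu hq
        · exact hκ hu
      have hadj : (openGraph (C₁ \ F)).Adj u w := (openGraph_adj _ u w).2 ⟨⟨h1, hnF⟩, hne⟩
      exact ⟨hu.trans hadj.reachable, hadj⟩)
  have hat : (openGraph (C₁ \ F)).Reachable a t := key.2
  rcases ht with rfl | rfl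
  · exact hκ hat
  · exact hTQ t hat (by rw [hQ]; exact SimpleGraph.Reachable.refl t)

end Residual

section Finitary

/-- **On the residual `R₀` both collars separate.**  For a pair `(C₂, C₁)` in the set `R₀` of ✓ p611369
`productRow_le_two_add_Pr2W` (`C₂ ∈ a|b|c`, `C₁ ∈ abc`, both single seals and both cut-off swaps failing):
`C_b(C₂) ∖ {b}` separates `a` from `b` and from `c` in `C₁`, and `C_c(C₂) ∖ {c}` separates `a` from `b` and from `c` in `C₁`.
[this work] -/
theorem R0_double_separator (a b c : V) (x : Finset (Sym2 V) × Finset (Sym2 V))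
    (hx : (¬ (openGraph (↑x.1 : Set (Sym2 V))).Reachable a b ∧ ¬ (openGraph (↑x.1 : Set (Sym2 V))).Reachable a c ∧
          ¬ (openGraph (↑x.1 : Set (Sym2 V))).Reachable b c) ∧
        ((openGraph (↑x.2 : Set (Sym2 V))).Reachable a b ∧ (openGraph (↑x.2 : Set (Sym2 V))).Reachable a c) ∧
        ¬ (openGraph ((↑x.2 : Set (Sym2 V)) \
            {e | ∃ v ∈ {v | (openGraph (↑x.1 : Set (Sym2 V))).Reachable c v}, v ∈ e})).Reachable a b ∧
        ¬ (openGraph ((↑x.2 : Set (Sym2 V)) \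
            {e | ∃ v ∈ {v | (openGraph (↑x.1 : Set (Sym2 V))).Reachable b v}, v ∈ e})).Reachable a c ∧
        ¬ (openGraph ((↑x.2 : Set (Sym2 V)) \
            {e | ∃ q ∈ {q | (openGraph ((↑x.2 : Set (Sym2 V)) \
                  {e | ∃ v ∈ {v | (openGraph (↑x.1 : Set (Sym2 V))).Reachable b v}, v ∈ e})).Reachable c q},
                 ∃ s ∈ {v | (openGraph (↑x.1 : Set (Sym2 V))).Reachable b v}, e = s(q, s)})).Reachable a b ∧
        ¬ (openGraph ((↑x.2 : Set (Sym2 V)) \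
            {e | ∃ q ∈ {q | (openGraph ((↑x.2 : Set (Sym2 V)) \
                  {e | ∃ v ∈ {v | (openGraph (↑x.1 : Set (Sym2 V))).Reachable c v}, v ∈ e})).Reachable b q},
                 ∃ s ∈ {v | (openGraph (↑x.1 : Set (Sym2 V))).Reachable c v}, e = s(q, s)})).Reachable a c) :
    (¬ (openGraph ((↑x.2 : Set (Sym2 V)) \
          {e | ∃ v ∈ {v | (openGraph (↑x.1 : Set (Sym2 V))).Reachable b v}, v ≠ b ∧ v ∈ e})).Reachable a b ∧
       ¬ (openGraph ((↑x.2 : Set (Sym2 V)) \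
          {e | ∃ v ∈ {v | (openGraph (↑x.1 : Set (Sym2 V))).Reachable b v}, v ≠ b ∧ v ∈ e})).Reachable a c) ∧
      (¬ (openGraph ((↑x.2 : Set (Sym2 V)) \
          {e | ∃ v ∈ {v | (openGraph (↑x.1 : Set (Sym2 V))).Reachable c v}, v ≠ c ∧ v ∈ e})).Reachable a b ∧
       ¬ (openGraph ((↑x.2 : Set (Sym2 V)) \
          {e | ∃ v ∈ {v | (openGraph (↑x.1 : Set (Sym2 V))).Reachable c v}, v ≠ c ∧ v ∈ e})).Reachable a c) := by
  obtain ⟨hsep, -, hsc, hsb, hkc, hkb⟩ := hx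
  have hcS : c ∉ {v | (openGraph (↑x.1 : Set (Sym2 V))).Reachable b v} := fun h => hsep.2.2 h
  have hbS : b ∉ {v | (openGraph (↑x.1 : Set (Sym2 V))).Reachable c v} := fun h => hsep.2.2 h.symm
  refine ⟨⟨?_, ?_⟩, ⟨?_, ?_⟩⟩
  · exact residual_separator (↑x.2) (↑x.1) a b c _ _ _ _ rfl rfl rfl rfl hcS (fun h => hsb h.symm) hkc (Or.inl rfl)
  · exact residual_separator (↑x.2) (↑x.1) a b c _ _ _ _ rfl rfl rfl rfl hcS (fun h => hsb h.symm) hkc (Or.inr rfl)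
  · exact residual_separator (↑x.2) (↑x.1) a c b _ _ _ _ rfl rfl rfl rfl hbS (fun h => hsc h.symm) hkb (Or.inr rfl)
  · exact residual_separator (↑x.2) (↑x.1) a c b _ _ _ _ rfl rfl rfl rfl hbS (fun h => hsc h.symm) hkb (Or.inl rfl)

end Finitary

end ThreeClusterSwap

end Summit.CriticalPhenomena.PercolationContinuityZ3.Theorems
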